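import Summits.AtomisticToContinuum.FouriersLaw.Theorems.HiddenChargeMazurOddChargeAlgebraToolkitB
import Summits.AtomisticToContinuum.FouriersLaw.Theorems.HiddenChargeMazurOddChargeAlgebraEnds

/-!
# Odd conservation laws of the pinned anharmonic chain — the leading pair of high momentum degree

File `PairHigh` of the NEGATIVE edge of crux `HiddenChargeMazur.OddChargeExists`
(item stmt-AtomisticToContinuum-13511).  For the leading pair `(F, H)` of an aligned odd density
of span `D ≥ 1` — `F` on the sites `0..D` of momentum degree `d ≥ 2`, `H` on the sites `0..D-1`
of momentum degree `d + 2` — the two symbol equations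

* `(α)  bup D F = 0`,
* `(β)  A⁺ F + bup (D-1) H = 0`

force `F` to be free of the site `0` (`∂_{q_0} F = ∂_{p_0} F = 0`), contradicting alignment.

Proof (`pair_high`): `(α)` and the two-ended factorisation give `∂_{p_0} F = cub(q_D,q_{D-1})·ν`,
`∂_{p_D} F = -cub(q_0,q_1)·S ν`; applying `∂_{p_0} ∂_{p_D}` to `(β)` yields the functional
equation `γ_{D-1}² ν = γ_0² S ν`, whence `ν = c·∏ γ_j²` (`nu_form`) is a polynomial in the
positions; but `∂_{p_0} F` has momentum degree `d - 1 ≥ 1`, so `ν = 0`.  Then the rows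
`∂_{p_0} (β)`, `∂_{p_D} (β)` express `∂_{q_0} F`, `∂_{q_D} F` through
`Ξ = ∂_{p_0} ∂_{p_{D-1}} H`, and cross-differentiation gives the same functional equation for
`Ξ`, of momentum degree `d ≥ 2`; hence `Ξ = 0` and `∂_{q_0} F = 0`. [folklore]
-/

noncomputable section

open MvPolynomial
open scoped BigOperators

namespace Summit.AtomisticToContinuum.FouriersLaw.Theorems.OddChargeAlgebra

/-! ### Private toolkit -/

/-- A polynomial on the sites `a..b` is free of `q_x` for `x` outside `[a, b]`. [folklore] -/
private theorem pderiv_inl_eq_zero_aux {a b : ℤ} {f : R}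
    (hf : f ∈ supported ℝ (Var.site ⁻¹' Set.Icc a b)) {x : ℤ} (hx : x < a ∨ b < x) :
    pderiv (Sum.inl x) f = 0 := by
  refine pderiv_eq_zero_of_not_mem_supported hf fun h => ?_
  have h' : a ≤ x ∧ x ≤ b := h
  omega

/-- A polynomial on the sites `a..b` is free of `p_x` for `x` outside `[a, b]`. [folklore] -/
private theorem pderiv_inr_eq_zero_aux {a b : ℤ} {f : R}
    (hf : f ∈ supported ℝ (Var.site ⁻¹' Set.Icc a b)) {x : ℤ} (hx : x < a ∨ b < x) :
    pderiv (Sum.inr x) f = 0 := by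
  refine pderiv_eq_zero_of_not_mem_supported hf fun h => ?_
  have h' : a ≤ x ∧ x ≤ b := h
  omega

/-- Polynomials in the positions have momentum weight `0`. [folklore] -/
private theorem isWeightedHomogeneous_pwt_zero_aux {f : R}
    (hf : f ∈ supported ℝ (Set.range (Sum.inl : ℤ → Var))) : IsWeightedHomogeneous pwt f 0 := by
  change f ∈ Algebra.adjoin ℝ _ at hf
  induction hf using Algebra.adjoin_induction with
  | mem g hg =>
    obtain ⟨v, ⟨y, rfl⟩, rfl⟩ := hg
    exact isWeightedHomogeneous_X ℝ pwt (Sum.inl y)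
  | algebraMap r =>
    rw [MvPolynomial.algebraMap_eq]
    exact isWeightedHomogeneous_C pwt r
  | add g g' _ _ hg hg' => exact hg.add hg'
  | mul g g' _ _ hg hg' => simpa using hg.mul hg'

/-- Constants are supported everywhere. [folklore] -/
private theorem C_mem_supported_aux (s : Set Var) (c : ℝ) : (C c : R) ∈ supported ℝ s := by
  rw [← MvPolynomial.algebraMap_eq]
  exact Subalgebra.algebraMap_mem _ c

/-- Positions are polynomials in the positions. [folklore] -/
private theorem X_inl_mem_supported_aux (x : ℤ) :
    (X (Sum.inl x) : R) ∈ supported ℝ (Set.range (Sum.inl : ℤ → Var)) :=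
  X_mem_supported.2 ⟨x, rfl⟩

/-- `∏ γ_j²` is a polynomial in the positions. [folklore] -/
private theorem prodsq_mem_supported_aux (s : Finset ℤ) :
    prodsq s ∈ supported ℝ (Set.range (Sum.inl : ℤ → Var)) :=
  prod_mem fun j _ =>
    pow_mem (sub_mem (X_inl_mem_supported_aux j) (X_inl_mem_supported_aux (j + 1))) 2

/-- Cancelling the `3`: `3 (q_D - q_{D-1})² f = 3 (q_0 - q_1)² g` is `γ_{D-1}² f = γ_0² g`.
[folklore] -/
private theorem diamond_aux {D : ℤ} {f g : R}
    (h : 3 * (X (Sum.inl D) - X (Sum.inl (D - 1))) ^ 2 * f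
      = 3 * (X (Sum.inl 0) - X (Sum.inl 1)) ^ 2 * g) :
    gam (D - 1) ^ 2 * f = gam 0 ^ 2 * g := by
  have h3 : (3 : R) ≠ 0 := by
    rw [← map_ofNat C 3, Ne, C_eq_zero]
    norm_num
  have e : (3 : R) * (gam (D - 1) ^ 2 * f - gam 0 ^ 2 * g) = 0 := by
    simp only [gam, sub_add_cancel, zero_add]
    linear_combination h
  exact sub_eq_zero.1 ((mul_eq_zero.1 e).resolve_left h3)

/-- The functional equation `γ_{D-1}² f = γ_0² S f` has no nonzero solution of positive momentum
weight: by `nu_form` a solution is `c·∏ γ_j²`, of momentum weight `0`. [folklore] -/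
private theorem eq_zero_of_diamond_aux {D : ℤ} (hD : 1 ≤ D) {f : R} {n : ℕ} (hn : n ≠ 0)
    (hf : IsWeightedHomogeneous pwt f n) (h : gam (D - 1) ^ 2 * f = gam 0 ^ 2 * shift f) :
    f = 0 := by
  obtain ⟨c, hc⟩ := nu_form hD f h
  by_contra hne
  have h0 : IsWeightedHomogeneous pwt f 0 := by
    rw [hc]
    exact isWeightedHomogeneous_pwt_zero_aux
      (mul_mem (C_mem_supported_aux _ c) (prodsq_mem_supported_aux _))
  exact hn (IsWeightedHomogeneous.inj_right hne hf h0)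

/-! ### The headline fact -/

/-- PAIR-HIGH.  For `D ≥ 1`, `F` on the sites `0..D` of momentum degree `d ≥ 2` and `H` on the
sites `0..D-1` of momentum degree `d + 2` with `bup D F = 0` and `A⁺ F + bup (D-1) H = 0`, the
polynomial `F` is free of the site `0`: `∂_{q_0} F = 0` and `∂_{p_0} F = 0`. [folklore] -/
theorem pair_high : ∀ {D : ℤ}, 1 ≤ D → ∀ (F H : R) (d : ℕ), 2 ≤ d →
    F ∈ supported ℝ (Var.site ⁻¹' Set.Icc (0 : ℤ) D) → IsWeightedHomogeneous pwt F d →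
    H ∈ supported ℝ (Var.site ⁻¹' Set.Icc (0 : ℤ) (D - 1)) →
    IsWeightedHomogeneous pwt H (d + 2) → bup D F = 0 → Aplus F + bup (D - 1) H = 0 →
    pderiv (Sum.inl 0) F = 0 ∧ pderiv (Sum.inr 0) F = 0 := by
  intro D hD F H d hd hF hFh hH hHh hα hβ
  have hDD1 : D ≠ D - 1 := by omega
  have h01 : (0 : ℤ) ≠ 1 := by omega
  -- (a) the boundary equation `(α)` and the two-ended factorisation
  have hα' : cub (X (Sum.inl (D + 1))) (X (Sum.inl D)) * pderiv (Sum.inr D) F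
      + cub (X (Sum.inl 0)) (X (Sum.inl 1)) * shift (pderiv (Sum.inr 0) F) = 0 := hα
  have hXs : shift (pderiv (Sum.inr 0) F)
      ∈ supported ℝ (Var.site ⁻¹' Set.Icc (1 : ℤ) (D + 1)) := by
    simpa using shift_mem_supported_site (pderiv_mem_supported hF (Sum.inr 0))
  have hYs : -pderiv (Sum.inr D) F ∈ supported ℝ (Var.site ⁻¹' Set.Icc (0 : ℤ) D) :=
    neg_mem (pderiv_mem_supported hF _)
  have hX0 : pderiv (Sum.inl 0) (shift (pderiv (Sum.inr 0) F)) = 0 :=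
    pderiv_inl_eq_zero_aux hXs (by omega)
  have hY0 : pderiv (Sum.inl (D + 1)) (-pderiv (Sum.inr D) F) = 0 := by
    rw [map_neg, pderiv_inl_eq_zero_aux (pderiv_mem_supported hF _) (Or.inr (lt_add_one D)),
      neg_zero]
  obtain ⟨T, hTs, hT0, -, hXT, hYT⟩ :=
    two_ended_factor hD hXs hYs hX0 hY0 (by linear_combination hα')
  obtain ⟨ν, rfl⟩ : ∃ ν : R, shift ν = T := ⟨shiftBy (-1) T, shift_shiftBy_neg_one T⟩
  have hνs : ν ∈ supported ℝ (Var.site ⁻¹' Set.Icc (0 : ℤ) (D - 1)) := by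
    have h := shiftBy_mem_supported (-1) hTs
    rw [shiftBy_neg_one_shift] at h
    refine supported_mono ?_ h
    rintro _ ⟨v, ⟨hv1, hv2⟩, rfl⟩
    simp only [Set.mem_preimage, Set.mem_Icc, site_transl] at hv1 hv2 ⊢
    omega
  have hF0 : pderiv (Sum.inr 0) F = cub (X (Sum.inl D)) (X (Sum.inl (D - 1))) * ν := by
    apply shift_injective
    rw [hXT, map_mul, shift_cub, shift_X_inl, shift_X_inl, sub_add_cancel]
  have hFD : pderiv (Sum.inr D) F = -(cub (X (Sum.inl 0)) (X (Sum.inl 1)) * shift ν) := by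
    rw [← hYT, neg_neg]
  have hνpD : pderiv (Sum.inr D) ν = 0 := pderiv_inr_eq_zero_aux hνs (by omega)
  have hνqD : pderiv (Sum.inl D) ν = 0 := pderiv_inl_eq_zero_aux hνs (by omega)
  -- the rows `∂_{p_0} (β)` and `∂_{p_D} (β)`
  obtain ⟨Ξ, hΞ⟩ : ∃ Ξ : R, pderiv (Sum.inr 0) (pderiv (Sum.inr (D - 1)) H) = Ξ := ⟨_, rfl⟩
  have hΞs : Ξ ∈ supported ℝ (Var.site ⁻¹' Set.Icc (0 : ℤ) (D - 1)) := by
    rw [← hΞ]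
    exact pderiv_mem_supported (pderiv_mem_supported hH _) _
  have hΞw : IsWeightedHomogeneous pwt Ξ d := by
    rw [← hΞ]
    exact (hHh.pderiv (show d + 1 + 1 = d + 2 by omega)).pderiv rfl
  have hΞpD : pderiv (Sum.inr D) Ξ = 0 := pderiv_inr_eq_zero_aux hΞs (by omega)
  have hΞqD : pderiv (Sum.inl D) Ξ = 0 := pderiv_inl_eq_zero_aux hΞs (by omega)
  have hSΞq0 : pderiv (Sum.inl 0) (shift Ξ) = 0 := by
    have h : pderiv (Sum.inl (0 - 1)) Ξ = 0 := pderiv_inl_eq_zero_aux hΞs (by omega)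
    rw [pderiv_inl_shift', h, map_zero]
  have hbup : bup (D - 1) H
      = cub (X (Sum.inl D)) (X (Sum.inl (D - 1))) * pderiv (Sum.inr (D - 1)) H
        + cub (X (Sum.inl 0)) (X (Sum.inl 1)) * shift (pderiv (Sum.inr 0) H) := by
    simp only [bup, sub_add_cancel]
  have h0S : pderiv (Sum.inr 0) (shift (pderiv (Sum.inr 0) H)) = 0 := by
    have h : pderiv (Sum.inr (0 - 1)) (pderiv (Sum.inr 0) H) = 0 :=
      pderiv_inr_eq_zero_aux (pderiv_mem_supported hH _) (by omega)
    rw [pderiv_inr_shift', h, map_zero]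
  have hDS : pderiv (Sum.inr D) (shift (pderiv (Sum.inr 0) H)) = shift Ξ := by
    rw [pderiv_inr_shift', ← hΞ]
    exact congrArg shift (pderiv_comm _ _ _)
  have hHD : pderiv (Sum.inr (D - 1)) (pderiv (Sum.inr D) H) = 0 := by
    rw [pderiv_inr_eq_zero_aux hH (Or.inr (by omega)), map_zero]
  have row0 : Aplus (pderiv (Sum.inr 0) F) + pderiv (Sum.inl 0) F
      + cub (X (Sum.inl D)) (X (Sum.inl (D - 1))) * Ξ = 0 := by
    have e := congrArg (pderiv (Sum.inr 0)) hβ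
    rw [map_add, map_zero, pderiv_inr_Aplus, hbup, map_add, pderiv_mul, pderiv_mul,
      pderiv_inr_cub, pderiv_inr_cub, h0S, hΞ] at e
    linear_combination e
  have rowD : Aplus (pderiv (Sum.inr D) F) + pderiv (Sum.inl D) F
      + cub (X (Sum.inl 0)) (X (Sum.inl 1)) * shift Ξ = 0 := by
    have e := congrArg (pderiv (Sum.inr D)) hβ
    rw [map_add, map_zero, pderiv_inr_Aplus, hbup, map_add, pderiv_mul, pderiv_mul,
      pderiv_inr_cub, pderiv_inr_cub, pderiv_comm (Sum.inr D) (Sum.inr (D - 1)) H, hHD,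
      hDS] at e
    linear_combination e
  -- (b) `∂_{p_D}` of row `0`: the functional equation `(◆)` for `ν`
  have hPDP0 : pderiv (Sum.inr D) (pderiv (Sum.inr 0) F) = 0 := by
    rw [hF0, pderiv_mul, pderiv_inr_cub, hνpD, zero_mul, mul_zero, add_zero]
  have hQDP0 : pderiv (Sum.inl D) (pderiv (Sum.inr 0) F)
      = 3 * (X (Sum.inl D) - X (Sum.inl (D - 1))) ^ 2 * ν := by
    rw [hF0, pderiv_mul, pderiv_inl_cub_left hDD1, hνqD, mul_zero, add_zero]
  have hQ0PD : pderiv (Sum.inl 0) (pderiv (Sum.inr D) F)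
      = -(3 * (X (Sum.inl 0) - X (Sum.inl 1)) ^ 2 * shift ν) := by
    rw [hFD, map_neg, pderiv_mul, pderiv_inl_cub_left h01, hT0, mul_zero, add_zero]
  have hPDΞ : pderiv (Sum.inr D) (cub (X (Sum.inl D)) (X (Sum.inl (D - 1))) * Ξ) = 0 := by
    rw [pderiv_mul, pderiv_inr_cub, hΞpD, zero_mul, mul_zero, add_zero]
  have eb := congrArg (pderiv (Sum.inr D)) row0
  rw [map_add, map_add, map_zero, pderiv_inr_Aplus, hPDP0, map_zero, hQDP0,
    pderiv_comm (Sum.inr D) (Sum.inl 0) F, hQ0PD, hPDΞ] at eb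
  have hdiamond : gam (D - 1) ^ 2 * ν = gam 0 ^ 2 * shift ν :=
    diamond_aux (by linear_combination eb)
  -- (c) `ν = c·∏ γ_j²` has momentum weight `0`, `∂_{p_0} F` has momentum weight `d - 1 ≥ 1`
  obtain ⟨c, hc⟩ := nu_form hD ν hdiamond
  have hP0 : pderiv (Sum.inr 0) F = 0 := by
    by_contra hne
    have hw1 : IsWeightedHomogeneous pwt (pderiv (Sum.inr 0) F) (d - 1) :=
      hFh.pderiv (show d - 1 + 1 = d by omega)
    have hw0 : IsWeightedHomogeneous pwt (pderiv (Sum.inr 0) F) 0 := by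
      rw [hF0, hc]
      exact isWeightedHomogeneous_pwt_zero_aux (mul_mem
        (cub_mem_supported (X_inl_mem_supported_aux _) (X_inl_mem_supported_aux _))
        (mul_mem (C_mem_supported_aux _ c) (prodsq_mem_supported_aux _)))
    have := IsWeightedHomogeneous.inj_right hne hw1 hw0
    omega
  have hν0 : ν = 0 := by
    rw [hP0] at hF0
    exact (mul_eq_zero.1 hF0.symm).resolve_left (cub_inl_ne_zero hDD1)
  have hPD : pderiv (Sum.inr D) F = 0 := by
    rw [hFD, hν0, map_zero, mul_zero, neg_zero]
  -- (d) the rows and cross-differentiation: the functional equation `(◆)` for `Ξ`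
  have hq0 : pderiv (Sum.inl 0) F = -(cub (X (Sum.inl D)) (X (Sum.inl (D - 1))) * Ξ) := by
    rw [hP0, map_zero] at row0
    linear_combination row0
  have hqD : pderiv (Sum.inl D) F = -(cub (X (Sum.inl 0)) (X (Sum.inl 1)) * shift Ξ) := by
    rw [hPD, map_zero] at rowD
    linear_combination rowD
  have cross := pderiv_comm (Sum.inl D) (Sum.inl 0) F
  rw [hq0, hqD, map_neg, map_neg, pderiv_mul, pderiv_mul, pderiv_inl_cub_left hDD1,
    pderiv_inl_cub_left h01, hΞqD, hSΞq0] at cross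
  have hΞ0 : Ξ = 0 :=
    eq_zero_of_diamond_aux hD (by omega) hΞw (diamond_aux (by linear_combination -cross))
  refine ⟨?_, hP0⟩
  rw [hq0, hΞ0, mul_zero, neg_zero]

end Summit.AtomisticToContinuum.FouriersLaw.Theorems.OddChargeAlgebra

end
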